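import Mathlib
import Literature.Analysis.FluidPDE.Tao2016AveragedNS.SelfSimilarCascadeResidues
import Literature.Analysis.FluidPDE.Tao2016AveragedNS.BoundedEternalSolutions
import HarnessLib

/-!
# `TransitMassLedger.LedgerRigidity` — the mass certificate and the windowed ledger, pointwise part
# (helper file for item stmt-NavierStokesRegularity-24398; `--supports`)

An OUTFLOW-COERCIVE MASS CERTIFICATE `(ℓ, θ, κ)` of a table `α` on the unit ball is the hypothesis
`κ‖A x − A y‖² ≤ ⟪ℓ, Q x + A x + B(y,x)⟫ + θ x − θ y` (`‖x‖, ‖y‖ ≤ 1`, `κ > 0`, `θ 0 = 0`) of the crux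
`LedgerRigidity` (`Q, A, B = tableQ α, tableA α, tableB α`).  This file records its elementary
consequences and the pointwise (fixed-time) algebra of the ledger argument:

* `θ x ≤ −κ‖A x‖² ≤ 0` and `−θ x ≤ ‖ℓ‖(C_Q + C_A)‖x‖²` on the unit ball (`theta_le`, `neg_theta_le`,
  `abs_theta_le`; substitute `x = 0` resp. `y = 0`);
* the WINDOWED LEDGER INEQUALITY at a fixed time (`window_pointwise`): along a solution `V` of the
  `λ = 1` lattice, `Σ_(i<w) κ‖A V_(a+i) − A V_(a+i+1)‖²` is bounded by the time-derivative of the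
  windowed ledger `Σ_(i<w) ⟪ℓ, V_(a+i)⟫` plus two boundary outflow terms and two boundary `θ` terms
  (the certificate summed over the window, the `A`-terms re-indexed, the `θ`-terms telescoped);
* the Cauchy–Schwarz bound `|Σ_(i<w) ⟪ℓ, V_(a+i)⟫| ≤ ‖ℓ‖ √(w·E)` (`abs_windowLedger_le`);
* LOCAL COERCIVITY (`posPart_outflow_sq_le`): if the `r` shells above `n` carry energy `≤ E` and
  `C_A E ≤ r η`, then `(‖A V_n‖ − η)₊² ≤ r Σ_(j<r) ‖A V_(n+j) − A V_(n+j+1)‖²` (pigeonhole + telescoping);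
* the pointwise inequality `η (‖A x‖ − √(2ηC_A)‖x‖) ≤ (‖A x‖ − η)₊²` (`key_pointwise`) and the
  double-sum bound `Σ_(i<w) Σ_(j<r) d_(i+j) ≤ r Σ_(i<w+r) d_i` (`sum_sum_shift_le`).

HONEST FRAMING: elementary inequalities about the structure maps of a MODEL lattice ODE (Tao 2016 §4);
nothing here concerns the Navier–Stokes equations.  No item is closed by this file.
-/

noncomputable section

set_option linter.dupNamespace false

namespace Summit.NavierStokesRegularity.NavierStokesRegularity.Theorems

namespace TransitMassLedgerLedger

open MeasureTheory Filter Topology Finset intervalIntegral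
open scoped RealInnerProductSpace
open Literature.Analysis.FluidPDE Literature.Analysis.FluidPDE.TaoCascade

variable {m : ℕ}

/-! ## The structure maps vanish at the origin -/

/-- `Q 0 = 0`. [cite: Tao2016AveragedNS, §4 (4.1); cell lemma `norm_tableQ_le`] -/
theorem tableQ_zero (α : Fin m → Fin m → Fin m → ℤ × ℤ × ℤ → ℝ) : tableQ α 0 = 0 := by
  have h := norm_tableQ_le α 0
  rw [norm_zero, zero_pow two_ne_zero, mul_zero] at h
  exact norm_le_zero_iff.1 h

/-- `A 0 = 0`. [cite: Tao2016AveragedNS, §4 (4.1); cell lemma `norm_tableA_le`] -/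
theorem tableA_zero (α : Fin m → Fin m → Fin m → ℤ × ℤ × ℤ → ℝ) : tableA α 0 = 0 := by
  have h := norm_tableA_le α 0
  rw [norm_zero, zero_pow two_ne_zero, mul_zero] at h
  exact norm_le_zero_iff.1 h

/-- `B(0, x) = 0`. [cite: Tao2016AveragedNS, §4 (4.1); cell lemma `norm_tableB_le`] -/
theorem tableB_zero_left (α : Fin m → Fin m → Fin m → ℤ × ℤ × ℤ → ℝ) (x : Em m) :
    tableB α 0 x = 0 := by
  have h := norm_tableB_le α 0 x
  rw [norm_zero, mul_zero, zero_mul] at h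
  exact norm_le_zero_iff.1 h

/-- `B(y, 0) = 0`. [cite: Tao2016AveragedNS, §4 (4.1); cell lemma `norm_tableB_le`] -/
theorem tableB_zero_right (α : Fin m → Fin m → Fin m → ℤ × ℤ × ℤ → ℝ) (y : Em m) :
    tableB α y 0 = 0 := by
  have h := norm_tableB_le α y 0
  rw [norm_zero, mul_zero] at h
  exact norm_le_zero_iff.1 h

/-! ## Consequences of the certificate for `θ` -/

section Certificate

variable {α : Fin m → Fin m → Fin m → ℤ × ℤ × ℤ → ℝ} {ℓ : Em m} {θ : Em m → ℝ} {κ : ℝ}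

/-- **`θ ≤ −κ‖A·‖²` on the unit ball** (the certificate at `x = 0`).
[cite: Tao2016AveragedNS, §4 (4.1); route TransitMassLedger (certificate shape)] -/
theorem theta_le
    (hcert : ∀ x y : Em m, ‖x‖ ≤ 1 → ‖y‖ ≤ 1 →
      κ * ‖tableA α x - tableA α y‖ ^ 2 ≤ ⟪ℓ, tableQ α x + tableA α x + tableB α y x⟫ + θ x - θ y)
    (hθ0 : θ 0 = 0) {y : Em m} (hy : ‖y‖ ≤ 1) : θ y ≤ -(κ * ‖tableA α y‖ ^ 2) := by
  have h := hcert 0 y (by simp) hy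
  rw [tableQ_zero, tableA_zero, tableB_zero_right, zero_add, add_zero, inner_zero_right, hθ0,
    zero_sub, norm_neg] at h
  linarith

/-- **`−θ x ≤ ‖ℓ‖ (C_Q + C_A) ‖x‖²` on the unit ball** (the certificate at `y = 0`, for `κ ≥ 0`).
[cite: Tao2016AveragedNS, §4 (4.1); route TransitMassLedger (certificate shape)] -/
theorem neg_theta_le
    (hcert : ∀ x y : Em m, ‖x‖ ≤ 1 → ‖y‖ ≤ 1 →
      κ * ‖tableA α x - tableA α y‖ ^ 2 ≤ ⟪ℓ, tableQ α x + tableA α x + tableB α y x⟫ + θ x - θ y)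
    (hθ0 : θ 0 = 0) (hκ : 0 ≤ κ) {x : Em m} (hx : ‖x‖ ≤ 1) :
    -θ x ≤ ‖ℓ‖ * (shiftConst α (0, 0, 0) + shiftConst α (0, 0, 1)) * ‖x‖ ^ 2 := by
  have h := hcert x 0 hx (by simp)
  rw [tableB_zero_left, add_zero, hθ0, sub_zero] at h
  have h1 : ⟪ℓ, tableQ α x + tableA α x⟫ ≤ ‖ℓ‖ * (shiftConst α (0, 0, 0) + shiftConst α (0, 0, 1))
      * ‖x‖ ^ 2 := by
    calc ⟪ℓ, tableQ α x + tableA α x⟫ ≤ ‖ℓ‖ * ‖tableQ α x + tableA α x‖ := real_inner_le_norm _ _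
      _ ≤ ‖ℓ‖ * (shiftConst α (0, 0, 0) * ‖x‖ ^ 2 + shiftConst α (0, 0, 1) * ‖x‖ ^ 2) :=
          mul_le_mul_of_nonneg_left ((norm_add_le _ _).trans
            (add_le_add (norm_tableQ_le α x) (norm_tableA_le α x))) (norm_nonneg _)
      _ = ‖ℓ‖ * (shiftConst α (0, 0, 0) + shiftConst α (0, 0, 1)) * ‖x‖ ^ 2 := by ring
  have h2 : 0 ≤ κ * ‖tableA α x - tableA α 0‖ ^ 2 := by positivity
  linarith

/-- **`|θ x| ≤ ‖ℓ‖ (C_Q + C_A) ‖x‖²` on the unit ball.**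
[cite: Tao2016AveragedNS, §4 (4.1); route TransitMassLedger (certificate shape)] -/
theorem abs_theta_le
    (hcert : ∀ x y : Em m, ‖x‖ ≤ 1 → ‖y‖ ≤ 1 →
      κ * ‖tableA α x - tableA α y‖ ^ 2 ≤ ⟪ℓ, tableQ α x + tableA α x + tableB α y x⟫ + θ x - θ y)
    (hθ0 : θ 0 = 0) (hκ : 0 ≤ κ) {x : Em m} (hx : ‖x‖ ≤ 1) :
    |θ x| ≤ ‖ℓ‖ * (shiftConst α (0, 0, 0) + shiftConst α (0, 0, 1)) * ‖x‖ ^ 2 := by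
  have h1 := theta_le hcert hθ0 hx
  have h2 := neg_theta_le hcert hθ0 hκ hx
  have h3 : 0 ≤ κ * ‖tableA α x‖ ^ 2 := by positivity
  rw [abs_le]
  constructor <;> nlinarith

end Certificate

/-! ## The windowed ledger at a fixed time -/

section Window

variable {α : Fin m → Fin m → Fin m → ℤ × ℤ × ℤ → ℝ} {ℓ : Em m} {θ : Em m → ℝ} {κ : ℝ}
  {V : ℤ → ℝ → Em m}

/-- The one-shell ledger `⟪ℓ, V_n⟫` moves by `⟪ℓ, V_n'⟫`. [folklore] -/
theorem hasDerivAt_ledger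
    (hl : ∀ (n : ℤ) (s : ℝ), HasDerivAt (V n)
      (tableQ α (V n s) + tableA α (V (n - 1) s) + tableB α (V (n + 1) s) (V n s)) s)
    (ℓ : Em m) (n : ℤ) (s : ℝ) :
    HasDerivAt (fun s => ⟪ℓ, V n s⟫)
      ⟪ℓ, tableQ α (V n s) + tableA α (V (n - 1) s) + tableB α (V (n + 1) s) (V n s)⟫ s := by
  have h := (hasDerivAt_const s ℓ).inner ℝ (hl n s)
  simpa using h

/-- **The windowed ledger inequality at a fixed time.**  For the shells `a, a+1, …, a+w−1` of a solution
`V` of the unit ball, the certificate summed over the window gives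
`Σ_(i<w) κ‖A V_(a+i) − A V_(a+i+1)‖² ≤ Σ_(i<w) ⟪ℓ, V_(a+i)'⟫ + (⟪ℓ, A V_(a+w−1)⟫ − ⟪ℓ, A V_(a−1)⟫)
 + (θ V_a − θ V_(a+w))` — the `A`-terms re-indexed against the lattice law, the `θ`-terms telescoped.
[cite: Tao2016AveragedNS, §4 Lemma 4.1 (4.8) (the lattice law); route TransitMassLedger (ledger mechanism)] -/
theorem window_pointwise
    (hcert : ∀ x y : Em m, ‖x‖ ≤ 1 → ‖y‖ ≤ 1 →
      κ * ‖tableA α x - tableA α y‖ ^ 2 ≤ ⟪ℓ, tableQ α x + tableA α x + tableB α y x⟫ + θ x - θ y)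
    (hb : ∀ (n : ℤ) (s : ℝ), ‖V n s‖ ≤ 1) (a : ℤ) (w : ℕ) (s : ℝ) :
    ∑ i ∈ range w, κ * ‖tableA α (V (a + i) s) - tableA α (V (a + i + 1) s)‖ ^ 2 ≤
      (∑ i ∈ range w, ⟪ℓ, tableQ α (V (a + i) s) + tableA α (V (a + i - 1) s)
          + tableB α (V (a + i + 1) s) (V (a + i) s)⟫)
        + (⟪ℓ, tableA α (V (a + w - 1) s)⟫ - ⟪ℓ, tableA α (V (a - 1) s)⟫)
        + (θ (V a s) - θ (V (a + w) s)) := by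
  -- the certificate, shell by shell
  have hterm : ∀ i ∈ range w,
      κ * ‖tableA α (V (a + i) s) - tableA α (V (a + i + 1) s)‖ ^ 2 ≤
        ⟪ℓ, tableQ α (V (a + i) s) + tableA α (V (a + i - 1) s)
            + tableB α (V (a + i + 1) s) (V (a + i) s)⟫
          + (⟪ℓ, tableA α (V (a + (i + 1 : ℕ) - 1) s)⟫ - ⟪ℓ, tableA α (V (a + i - 1) s)⟫)
          + (θ (V (a + i) s) - θ (V (a + (i + 1 : ℕ)) s)) := by
    intro i _
    have h := hcert (V (a + i) s) (V (a + i + 1) s) (hb _ _) (hb _ _)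
    have e1 : a + ((i + 1 : ℕ) : ℤ) - 1 = a + i := by push_cast; ring
    have e2 : a + ((i + 1 : ℕ) : ℤ) = a + i + 1 := by push_cast; ring
    rw [e1, e2]
    rw [inner_add_right, inner_add_right] at h
    rw [inner_add_right, inner_add_right]
    linarith
  refine (Finset.sum_le_sum hterm).trans (le_of_eq ?_)
  rw [Finset.sum_add_distrib, Finset.sum_add_distrib,
    Finset.sum_range_sub (fun i => ⟪ℓ, tableA α (V (a + (i : ℕ) - 1) s)⟫),
    Finset.sum_range_sub' (fun i => θ (V (a + (i : ℕ)) s))]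
  push_cast
  ring_nf

/-- **Cauchy–Schwarz for the windowed ledger**: if the window carries energy `≤ E`, then
`|Σ_(i<w) ⟪ℓ, V_(a+i)⟫| ≤ ‖ℓ‖ √(w E)`. [folklore] -/
theorem abs_windowLedger_le (ℓ : Em m) (a : ℤ) (w : ℕ) (s : ℝ) {E : ℝ}
    (hE : ∑ i ∈ range w, ‖V (a + i) s‖ ^ 2 ≤ E) :
    |∑ i ∈ range w, ⟪ℓ, V (a + i) s⟫| ≤ ‖ℓ‖ * Real.sqrt (w * E) := by
  have h1 : |∑ i ∈ range w, ⟪ℓ, V (a + i) s⟫| ≤ ‖ℓ‖ * ∑ i ∈ range w, ‖V (a + i) s‖ := by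
    rw [Finset.mul_sum]
    exact (Finset.abs_sum_le_sum_abs _ _).trans
      (Finset.sum_le_sum fun i _ => abs_real_inner_le_norm _ _)
  have h2 : (∑ i ∈ range w, ‖V (a + i) s‖) ^ 2 ≤ w * E := by
    have hcs := Finset.sum_mul_sq_le_sq_mul_sq (range w) (fun _ => (1 : ℝ)) (fun i => ‖V (a + i) s‖)
    simp only [one_mul, one_pow, Finset.sum_const, Finset.card_range, nsmul_eq_mul, mul_one] at hcs
    exact hcs.trans (mul_le_mul_of_nonneg_left hE (Nat.cast_nonneg _))
  have h0 : 0 ≤ ∑ i ∈ range w, ‖V (a + i) s‖ := Finset.sum_nonneg fun i _ => norm_nonneg _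
  have h3 : ∑ i ∈ range w, ‖V (a + i) s‖ ≤ Real.sqrt (w * E) :=
    calc ∑ i ∈ range w, ‖V (a + i) s‖ = Real.sqrt ((∑ i ∈ range w, ‖V (a + i) s‖) ^ 2) :=
          (Real.sqrt_sq h0).symm
      _ ≤ Real.sqrt (w * E) := Real.sqrt_le_sqrt h2
  exact h1.trans (mul_le_mul_of_nonneg_left h3 (norm_nonneg _))

end Window

/-! ## Local coercivity: outflow is paid for by dissipation -/

/-- Telescoping + Cauchy–Schwarz: if `‖z_(j₀)‖ ≤ η` for some `j₀ ≤ r`, then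
`(‖z_0‖ − η)₊² ≤ r Σ_(j<r) ‖z_j − z_(j+1)‖²`. [folklore] -/
theorem posPart_sq_le_of_small {F : Type*} [SeminormedAddCommGroup F] (z : ℕ → F) {r j₀ : ℕ}
    (hj₀ : j₀ ≤ r) {η : ℝ} (hη : ‖z j₀‖ ≤ η) :
    (max (‖z 0‖ - η) 0) ^ 2 ≤ r * ∑ j ∈ range r, ‖z j - z (j + 1)‖ ^ 2 := by
  set S := ∑ j ∈ range r, ‖z j - z (j + 1)‖ with hS
  have hS0 : 0 ≤ S := Finset.sum_nonneg fun _ _ => norm_nonneg _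
  have h1 : ‖z 0‖ - η ≤ S := by
    have htel : z 0 - z j₀ = ∑ j ∈ range j₀, (z j - z (j + 1)) :=
      (Finset.sum_range_sub' z j₀).symm
    have h2 : ‖z 0‖ - ‖z j₀‖ ≤ ∑ j ∈ range j₀, ‖z j - z (j + 1)‖ :=
      calc ‖z 0‖ - ‖z j₀‖ ≤ ‖z 0 - z j₀‖ := norm_sub_norm_le _ _
        _ = ‖∑ j ∈ range j₀, (z j - z (j + 1))‖ := by rw [htel]
        _ ≤ ∑ j ∈ range j₀, ‖z j - z (j + 1)‖ := norm_sum_le _ _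
    have h3 : ∑ j ∈ range j₀, ‖z j - z (j + 1)‖ ≤ S :=
      Finset.sum_le_sum_of_subset_of_nonneg (Finset.range_subset_range.2 hj₀) fun _ _ _ => norm_nonneg _
    linarith
  have h4 : max (‖z 0‖ - η) 0 ≤ S := max_le h1 hS0
  have h5 : S ^ 2 ≤ r * ∑ j ∈ range r, ‖z j - z (j + 1)‖ ^ 2 := by
    have hcs := Finset.sum_mul_sq_le_sq_mul_sq (range r) (fun _ => (1 : ℝ)) (fun j => ‖z j - z (j + 1)‖)
    simp only [one_mul, one_pow, Finset.sum_const, Finset.card_range, nsmul_eq_mul, mul_one] at hcs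
    exact hcs
  exact (pow_le_pow_left₀ (le_max_right _ _) h4 2).trans h5

section Coercivity

variable {α : Fin m → Fin m → Fin m → ℤ × ℤ × ℤ → ℝ} {V : ℤ → ℝ → Em m}

/-- **Local coercivity.**  If the `r ≥ 1` shells above `n` carry energy `≤ E` at time `s` and
`C_A E ≤ r η`, then one of them has outflow `≤ η` (pigeonhole), so
`(‖A V_n‖ − η)₊² ≤ r Σ_(j<r) ‖A V_(n+j) − A V_(n+j+1)‖²` (telescoping + Cauchy–Schwarz).
[cite: Tao2016AveragedNS, §4 (4.1); route TransitMassLedger (coercivity of the certificate)] -/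
theorem posPart_outflow_sq_le (n : ℤ) (s : ℝ) {r : ℕ} (hr : 0 < r) {E η : ℝ}
    (hEsum : ∑ j ∈ range r, ‖V (n + 1 + j) s‖ ^ 2 ≤ E)
    (hη : shiftConst α (0, 0, 1) * E ≤ r * η) :
    (max (‖tableA α (V n s)‖ - η) 0) ^ 2 ≤
      r * ∑ j ∈ range r, ‖tableA α (V (n + j) s) - tableA α (V (n + j + 1) s)‖ ^ 2 := by
  -- pigeonhole: some shell among n+1, …, n+r has energy ≤ E / r
  have hne : (range r).Nonempty := Finset.nonempty_range_iff.2 (Nat.pos_iff_ne_zero.1 hr)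
  have hr' : (0 : ℝ) < r := Nat.cast_pos.2 hr
  have hsum' : ∑ j ∈ range r, ‖V (n + 1 + j) s‖ ^ 2 ≤ ∑ _j ∈ range r, E / r := by
    rw [Finset.sum_const, Finset.card_range, nsmul_eq_mul, mul_div_cancel₀ _ hr'.ne']
    exact hEsum
  obtain ⟨j, hj, hjE⟩ := Finset.exists_le_of_sum_le hne hsum'
  have hjr : j + 1 ≤ r := Finset.mem_range.1 hj
  -- the outflow of that shell is ≤ C_A E / r ≤ η
  have hsmall : ‖tableA α (V (n + ((j + 1 : ℕ) : ℤ)) s)‖ ≤ η := by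
    have e : n + ((j + 1 : ℕ) : ℤ) = n + 1 + j := by push_cast; ring
    rw [e]
    have hCA := shiftConst_nonneg α (0, 0, 1)
    calc ‖tableA α (V (n + 1 + j) s)‖ ≤ shiftConst α (0, 0, 1) * ‖V (n + 1 + j) s‖ ^ 2 :=
          norm_tableA_le α _
      _ ≤ shiftConst α (0, 0, 1) * (E / r) := mul_le_mul_of_nonneg_left hjE hCA
      _ = shiftConst α (0, 0, 1) * E / r := by ring
      _ ≤ η := by rw [div_le_iff₀ hr']; linarith
  have h := posPart_sq_le_of_small (fun j : ℕ => tableA α (V (n + j) s)) hjr hsmall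
  simp only [CharP.cast_eq_zero, add_zero, Nat.cast_add, Nat.cast_one] at h
  convert h using 4
  ring_nf

end Coercivity

/-! ## The pointwise key inequality and the double-sum bound -/

/-- **Key pointwise inequality.**  For `0 ≤ η`, `f ≤ C g²` and `t ≥ 0` with `t² = 2ηCg²`
(think `f = ‖A x‖`, `g = ‖x‖`, `t = √(2ηC_A)‖x‖`): `η (f − t) ≤ (f − η)₊²`.  (Either `f ≤ t`, or
`t ≥ 2η` and then `(f−η)² ≥ η(f − 2η) ≥ η(f − t)`.) [folklore] -/
theorem key_pointwise {f g η C t : ℝ} (hη : 0 ≤ η) (hfg : f ≤ C * g ^ 2) (ht : 0 ≤ t)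
    (ht2 : t ^ 2 = 2 * η * (C * g ^ 2)) : η * (f - t) ≤ (max (f - η) 0) ^ 2 := by
  rcases le_or_gt f t with hft | hft
  · have h0 : 0 ≤ (max (f - η) 0) ^ 2 := sq_nonneg _
    nlinarith
  · have ht2η : 2 * η ≤ t := by
      by_contra hlt
      push Not at hlt
      -- t < 2η forces η > 0, then t² ≥ 2ηf > 2ηt gives t > 2η: contradiction
      have hηpos : 0 < η := by linarith
      have h1 : t ^ 2 ≥ 2 * η * f := by rw [ht2]; nlinarith
      nlinarith
    have hmax : max (f - η) 0 = f - η := max_eq_left (by linarith)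
    rw [hmax]
    nlinarith [sq_nonneg (f - 3 / 2 * η)]

/-- **Double-sum bound**: for non-negative `d`, `Σ_(i<w) Σ_(j<r) d_(i+j) ≤ r Σ_(i<w+r) d_i`
(each index `i + j` is hit at most `r` times). [folklore] -/
theorem sum_sum_shift_le {d : ℕ → ℝ} (hd : ∀ i, 0 ≤ d i) (w r : ℕ) :
    ∑ i ∈ range w, ∑ j ∈ range r, d (i + j) ≤ r * ∑ i ∈ range (w + r), d i := by
  rw [Finset.sum_comm]
  have h : ∀ j ∈ range r, ∑ i ∈ range w, d (i + j) ≤ ∑ i ∈ range (w + r), d i := by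
    intro j hj
    have hj' := Finset.mem_range.1 hj
    calc ∑ i ∈ range w, d (i + j) = ∑ i ∈ Ico j (j + w), d i := by
          rw [Finset.sum_Ico_eq_sum_range, add_tsub_cancel_left]
          exact Finset.sum_congr rfl fun i _ => by rw [add_comm]
      _ ≤ ∑ i ∈ range (w + r), d i := by
          refine Finset.sum_le_sum_of_subset_of_nonneg (fun i hi => ?_) fun i _ _ => hd i
          simp only [Finset.mem_Ico, Finset.mem_range] at hi ⊢
          omega
  calc ∑ j ∈ range r, ∑ i ∈ range w, d (i + j) ≤ ∑ _j ∈ range r, ∑ i ∈ range (w + r), d i :=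
        Finset.sum_le_sum h
    _ = r * ∑ i ∈ range (w + r), d i := by
        rw [Finset.sum_const, Finset.card_range, nsmul_eq_mul]

/-! ## Time integrals against the action -/

/-- If `|h| ≤ c·g` pointwise with `g ≥ 0` integrable of total mass `≤ M` and `c ≥ 0`, then
`|∫_(s₁)^(s₂) h| ≤ c M` on every interval (`s₁ ≤ s₂`). [folklore] -/
theorem abs_intervalIntegral_le {h g : ℝ → ℝ} (hh : Continuous h) (hg : Continuous g)
    (hgi : Integrable g) {M c : ℝ} (hc : 0 ≤ c) (hgM : ∫ s, g s ≤ M) (hg0 : ∀ s, 0 ≤ g s)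
    (hle : ∀ s, |h s| ≤ c * g s) {s₁ s₂ : ℝ} (h12 : s₁ ≤ s₂) :
    |∫ s in s₁..s₂, h s| ≤ c * M := by
  have h1 : |∫ s in s₁..s₂, h s| ≤ ∫ s in s₁..s₂, |h s| :=
    intervalIntegral.abs_integral_le_integral_abs h12
  have h2 : ∫ s in s₁..s₂, |h s| ≤ ∫ s in s₁..s₂, c * g s :=
    intervalIntegral.integral_mono_on h12 (hh.abs.intervalIntegrable _ _)
      ((continuous_const.mul hg).intervalIntegrable _ _) fun s _ => hle s
  have h3 : ∫ s in s₁..s₂, c * g s = c * ∫ s in s₁..s₂, g s := intervalIntegral.integral_const_mul _ _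
  have h4 : ∫ s in s₁..s₂, g s ≤ M := by
    rw [intervalIntegral.integral_of_le h12]
    exact (setIntegral_le_integral hgi (Eventually.of_forall hg0)).trans hgM
  calc |∫ s in s₁..s₂, h s| ≤ c * ∫ s in s₁..s₂, g s := by linarith
    _ ≤ c * M := mul_le_mul_of_nonneg_left h4 hc

end TransitMassLedgerLedger

end Summit.NavierStokesRegularity.NavierStokesRegularity.Theorems

end
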